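import Summits.CriticalPhenomena.Ising3DConformalLimit.Theses.PerfectScreening
import Literature.Probability.LatticeModels.SRWReturnFourier

/-!
# Watson's integral, part A: the Wallis expansion of `∫_{[-π,π]³} (Σⱼ cos θⱼ)^m dθ`
(crux stmt-CriticalPhenomena-1341, line `certified-core-eventual-tail`, stub `stub_order_beyond_threshold`)

Towards the certified enclosure `latticeGreen (0 : Site 3) ≤ 13/25` (the last ingredient of
`stub_order_beyond_threshold`, see `…CcetOrder.lean`): the even moments of the free symbol
`c(θ) = Σⱼ cos θⱼ` on the Brillouin zone `[-π,π]³` in closed form,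
`∫ c^{2n} = (2π)³ · T(n) / 4^n` with the natural number
`T(n) = Σ_{a ≤ 2n} Σ_{b ≤ 2n-a} [a, b even] (2n)! / ((a/2)!² (b/2)!² ((2n-a-b)/2)!²)`
(kernel-evaluable: factorials and exact division only), and `∫ c^{2n+1} = 0`; from the binomial
theorem, Fubini on the product zone and Wallis' integrals `∫_{-π}^{π} cos^{2i} = 2π (2i)!/(4^i i!²)`,
`∫_{-π}^{π} cos^{2i+1} = 0`. These are the return probabilities `P(S_{2n} = 0) = T(n)/36^n` of the
simple random walk on `ℤ³` (Pólya 1921); `Σ_n T(n)/36^n = 3 · latticeGreen 0 = 1.516386…`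
(Watson 1939) is summed with a certified tail in part B.
-/

noncomputable section

namespace Summit.CriticalPhenomena.Ising3DConformalLimit.Theorems.PerfectScreening.CcetGreen

open MeasureTheory Finset Real intervalIntegral
open Literature.Probability.LatticeModels

/-! ### Wallis' integrals over a full period -/

/-- `∫_{[-π,π]} cos^k` as an interval integral. -/
theorem integral_Icc_cos_pow (k : ℕ) :
    ∫ t in Set.Icc (-π) π, Real.cos t ^ k = ∫ t in (-π)..π, Real.cos t ^ k := by
  rw [integral_Icc_eq_integral_Ioc, ← intervalIntegral.integral_of_le (by linarith [pi_pos])]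

/-- Wallis over a full period, even powers:
`∫_{-π}^{π} cos^{2i} = 2π ∏_{l<i} (2l+1)/(2l+2)`. -/
theorem intervalIntegral_cos_pow_even (i : ℕ) :
    ∫ t in (-π)..π, Real.cos t ^ (2 * i) = 2 * π * ∏ l ∈ range i, (2 * (l : ℝ) + 1) / (2 * l + 2) := by
  induction i with
  | zero => simp; ring
  | succ i ih =>
    rw [show 2 * (i + 1) = 2 * i + 2 by ring, integral_cos_pow, sin_pi, sin_neg, sin_pi, ih,
      prod_range_succ]
    push_cast
    ring

/-- Wallis over a full period, odd powers: `∫_{-π}^{π} cos^{2i+1} = 0`. -/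
theorem intervalIntegral_cos_pow_odd (i : ℕ) :
    ∫ t in (-π)..π, Real.cos t ^ (2 * i + 1) = 0 := by
  induction i with
  | zero => simp
  | succ i ih =>
    rw [show 2 * (i + 1) + 1 = (2 * i + 1) + 2 by ring, integral_cos_pow, sin_pi, sin_neg, sin_pi,
      ih]
    ring

/-- `(2i)!/(4^i (i!)²) = ∏_{l<i} (2l+1)/(2l+2)`. -/
theorem prod_wallis_eq (i : ℕ) :
    ∏ l ∈ range i, (2 * (l : ℝ) + 1) / (2 * l + 2) =
      ((2 * i).factorial : ℝ) / (4 ^ i * ((i.factorial : ℝ)) ^ 2) := by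
  induction i with
  | zero => simp
  | succ i ih =>
    rw [prod_range_succ, ih, show 2 * (i + 1) = (2 * i + 1) + 1 by ring, Nat.factorial_succ,
      Nat.factorial_succ, Nat.factorial_succ i]
    have h1 : ((i.factorial : ℕ) : ℝ) ≠ 0 := by exact_mod_cast i.factorial_ne_zero
    have h2 : ((2 * i).factorial : ℝ) ≠ 0 := by exact_mod_cast (2 * i).factorial_ne_zero
    push_cast
    field_simp
    ring

/-- The full-period cosine moments in closed form: `∫_{[-π,π]} cos^{2i} = 2π (2i)!/(4^i (i!)²)`. -/
theorem integral_Icc_cos_pow_two_mul (i : ℕ) :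
    ∫ t in Set.Icc (-π) π, Real.cos t ^ (2 * i) =
      2 * π * (((2 * i).factorial : ℝ) / (4 ^ i * ((i.factorial : ℝ)) ^ 2)) := by
  rw [integral_Icc_cos_pow, intervalIntegral_cos_pow_even, prod_wallis_eq]

/-- `∫_{[-π,π]} cos^{2i+1} = 0`. -/
theorem integral_Icc_cos_pow_two_mul_add_one (i : ℕ) :
    ∫ t in Set.Icc (-π) π, Real.cos t ^ (2 * i + 1) = 0 := by
  rw [integral_Icc_cos_pow, intervalIntegral_cos_pow_odd]

/-! ### Fubini on the Brillouin zone and the trinomial expansion -/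

/-- Product integrands factor over the product zone `[-π,π]^d`. -/
theorem integral_brillouin_prod_cos_pow {d : ℕ} (e : Fin d → ℕ) :
    ∫ θ in brillouin d, ∏ j, Real.cos (θ j) ^ (e j) =
      ∏ j, ∫ t in Set.Icc (-π) π, Real.cos t ^ (e j) := by
  rw [SRW.volume_restrict_brillouin,
    integral_fintype_prod_eq_prod (𝕜 := ℝ) (fun j (t : ℝ) => Real.cos t ^ (e j))]

/-- The trinomial expansion of `(cos θ₀ + cos θ₁ + cos θ₂)^m`. -/
theorem sum_cos_pow_eq (θ : Fin 3 → ℝ) (m : ℕ) :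
    (∑ j, Real.cos (θ j)) ^ m = ∑ a ∈ range (m + 1), ∑ b ∈ range (m - a + 1),
      ((m.choose a : ℝ) * ((m - a).choose b : ℝ)) *
        (Real.cos (θ 0) ^ a * Real.cos (θ 1) ^ b * Real.cos (θ 2) ^ (m - a - b)) := by
  rw [Fin.sum_univ_three, add_assoc, add_pow]
  refine Finset.sum_congr rfl fun a _ => ?_
  rw [add_pow, Finset.mul_sum, Finset.sum_mul]
  refine Finset.sum_congr rfl fun b _ => ?_
  rw [Nat.sub_sub]
  ring

/-- **The moments of the free symbol in Wallis form**:
`∫_{[-π,π]³} (Σⱼ cos θⱼ)^m = Σ_{a ≤ m} Σ_{b ≤ m-a} C(m,a) C(m-a,b) W(a) W(b) W(m-a-b)`,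
`W(k) = ∫_{[-π,π]} cos^k`. -/
theorem integral_sum_cos_pow (m : ℕ) :
    ∫ θ in brillouin 3, (∑ j, Real.cos (θ j)) ^ m =
      ∑ a ∈ range (m + 1), ∑ b ∈ range (m - a + 1),
        ((m.choose a : ℝ) * ((m - a).choose b : ℝ)) *
          ((∫ t in Set.Icc (-π) π, Real.cos t ^ a) * (∫ t in Set.Icc (-π) π, Real.cos t ^ b) *
            (∫ t in Set.Icc (-π) π, Real.cos t ^ (m - a - b))) := by
  have hK := isCompact_brillouin 3
  have hterm : ∀ a b : ℕ, ∫ θ in brillouin 3,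
      Real.cos (θ 0) ^ a * Real.cos (θ 1) ^ b * Real.cos (θ 2) ^ (m - a - b) =
      (∫ t in Set.Icc (-π) π, Real.cos t ^ a) * (∫ t in Set.Icc (-π) π, Real.cos t ^ b) *
        (∫ t in Set.Icc (-π) π, Real.cos t ^ (m - a - b)) := by
    intro a b
    have h := integral_brillouin_prod_cos_pow (d := 3) ![a, b, m - a - b]
    simp only [Fin.prod_univ_three, Matrix.cons_val_zero, Matrix.cons_val_one,
      Matrix.cons_val] at h
    exact h
  simp_rw [sum_cos_pow_eq]
  rw [MeasureTheory.integral_finsetSum]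
  · refine Finset.sum_congr rfl fun a _ => ?_
    rw [MeasureTheory.integral_finsetSum]
    · refine Finset.sum_congr rfl fun b _ => ?_
      rw [MeasureTheory.integral_const_mul, hterm]
    · intro b _
      exact ((by fun_prop : Continuous fun θ : Fin 3 → ℝ => ((m.choose a : ℝ) * ((m - a).choose b : ℝ)) *
        (Real.cos (θ 0) ^ a * Real.cos (θ 1) ^ b * Real.cos (θ 2) ^ (m - a - b)))).continuousOn.integrableOn_compact hK
  · intro a _
    refine MeasureTheory.integrable_finsetSum _ fun b _ => ?_
    exact ((by fun_prop : Continuous fun θ : Fin 3 → ℝ => ((m.choose a : ℝ) * ((m - a).choose b : ℝ)) *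
      (Real.cos (θ 0) ^ a * Real.cos (θ 1) ^ b * Real.cos (θ 2) ^ (m - a - b)))).continuousOn.integrableOn_compact hK


/-! ### The even moments as kernel-evaluable natural numbers -/

/-- Divisibility behind the trinomial term: `(i!)²(j!)²(k!)² ∣ (2(i+j+k))!`. -/
theorem factorial_sq_dvd (i j k : ℕ) :
    i.factorial ^ 2 * j.factorial ^ 2 * k.factorial ^ 2 ∣ (2 * (i + j + k)).factorial := by
  have h1 : i.factorial * j.factorial * k.factorial ∣ (i + j + k).factorial :=
    (mul_dvd_mul_right (Nat.factorial_mul_factorial_dvd_factorial_add i j) _).trans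
      (Nat.factorial_mul_factorial_dvd_factorial_add (i + j) k)
  have h2 : (i + j + k).factorial * (i + j + k).factorial ∣ (2 * (i + j + k)).factorial := by
    rw [two_mul]; exact Nat.factorial_mul_factorial_dvd_factorial_add _ _
  have h3 := (mul_dvd_mul h1 h1).trans h2
  rwa [show i.factorial * j.factorial * k.factorial * (i.factorial * j.factorial * k.factorial) =
    i.factorial ^ 2 * j.factorial ^ 2 * k.factorial ^ 2 by ring] at h3

/-- One even trinomial term: for `a = 2i`, `b = 2j`, `m - a - b = 2k`,
`C(2n,2i) C(2n-2i,2j) W(2i) W(2j) W(2k) = (2π)³ (2n)!/(4^n (i!)²(j!)²(k!)²)`, `n = i+j+k`. -/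
theorem term_even_eq (i j k : ℕ) :
    (((2 * (i + j + k)).choose (2 * i) : ℝ) * ((2 * (i + j + k) - 2 * i).choose (2 * j) : ℝ)) *
      ((∫ t in Set.Icc (-π) π, Real.cos t ^ (2 * i)) * (∫ t in Set.Icc (-π) π, Real.cos t ^ (2 * j)) *
        (∫ t in Set.Icc (-π) π, Real.cos t ^ (2 * (i + j + k) - 2 * i - 2 * j))) =
      (2 * π) ^ 3 * (((2 * (i + j + k)).factorial /
        (i.factorial ^ 2 * j.factorial ^ 2 * k.factorial ^ 2) : ℕ) : ℝ) / 4 ^ (i + j + k) := by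
  have e1 : 2 * (i + j + k) - 2 * i = 2 * (j + k) := by omega
  have e2 : 2 * (i + j + k) - 2 * i - 2 * j = 2 * k := by omega
  have e3 : 2 * (j + k) - 2 * j = 2 * k := by omega
  rw [e2, e1, integral_Icc_cos_pow_two_mul, integral_Icc_cos_pow_two_mul,
    integral_Icc_cos_pow_two_mul, Nat.cast_div (factorial_sq_dvd i j k) (by positivity),
    Nat.cast_choose ℝ (by omega : 2 * i ≤ 2 * (i + j + k)), e1,
    Nat.cast_choose ℝ (by omega : 2 * j ≤ 2 * (j + k)), e3]
  have h1 : ((i.factorial : ℕ) : ℝ) ≠ 0 := by exact_mod_cast i.factorial_ne_zero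
  have h2 : ((j.factorial : ℕ) : ℝ) ≠ 0 := by exact_mod_cast j.factorial_ne_zero
  have h3 : ((k.factorial : ℕ) : ℝ) ≠ 0 := by exact_mod_cast k.factorial_ne_zero
  have h4 : (((2 * i).factorial : ℕ) : ℝ) ≠ 0 := by exact_mod_cast (2 * i).factorial_ne_zero
  have h5 : (((2 * j).factorial : ℕ) : ℝ) ≠ 0 := by exact_mod_cast (2 * j).factorial_ne_zero
  have h6 : (((2 * k).factorial : ℕ) : ℝ) ≠ 0 := by exact_mod_cast (2 * k).factorial_ne_zero
  have h7 : (((2 * (j + k)).factorial : ℕ) : ℝ) ≠ 0 := by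
    exact_mod_cast (2 * (j + k)).factorial_ne_zero
  push_cast
  field_simp
  ring

/-- **Even moments, kernel-evaluable form**: `∫_{[-π,π]³} (Σⱼ cos θⱼ)^{2n} = (2π)³ T(n)/4^n` with
`T(n) = Σ_{a ≤ 2n} Σ_{b ≤ 2n-a} [a, b even] (2n)!/((a/2)!² (b/2)!² ((2n-a-b)/2)!²) ∈ ℕ`
(so that `P(S_{2n} = 0) = T(n)/36^n` for the simple random walk on `ℤ³`). -/
theorem ccetGreen_moment_even (n : ℕ) :
    ∫ θ in brillouin 3, (∑ j, Real.cos (θ j)) ^ (2 * n) =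
      (2 * π) ^ 3 * ((∑ a ∈ range (2 * n + 1), ∑ b ∈ range (2 * n - a + 1),
        (if Even a ∧ Even b then
          (2 * n).factorial / ((a / 2).factorial ^ 2 * (b / 2).factorial ^ 2 *
            ((2 * n - a - b) / 2).factorial ^ 2) else 0 : ℕ)) : ℝ) / 4 ^ n := by
  rw [integral_sum_cos_pow, Finset.mul_sum, Finset.sum_div]
  refine Finset.sum_congr rfl fun a ha => ?_
  rw [Finset.mul_sum, Finset.sum_div]
  refine Finset.sum_congr rfl fun b hb => ?_
  have ha' : a ≤ 2 * n := by have := Finset.mem_range.1 ha; omega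
  have hb' : b ≤ 2 * n - a := by have := Finset.mem_range.1 hb; omega
  rcases Nat.even_or_odd' a with ⟨i, rfl | rfl⟩
  · rcases Nat.even_or_odd' b with ⟨j, rfl | rfl⟩
    · -- both even
      obtain ⟨k, hk⟩ : ∃ k, n = i + j + k := ⟨n - i - j, by omega⟩
      subst hk
      have d1 : 2 * i / 2 = i := by omega
      have d2 : 2 * j / 2 = j := by omega
      have d3 : (2 * (i + j + k) - 2 * i - 2 * j) / 2 = k := by omega
      rw [if_pos ⟨even_two_mul i, even_two_mul j⟩, d1, d2, d3, term_even_eq i j k]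
    · -- `b` odd
      rw [integral_Icc_cos_pow_two_mul_add_one, if_neg (fun h => ?_)]
      · simp
      · exact Nat.not_even_iff_odd.2 ⟨j, rfl⟩ h.2
  · -- `a` odd
    rw [integral_Icc_cos_pow_two_mul_add_one, if_neg (fun h => ?_)]
    · simp
    · exact Nat.not_even_iff_odd.2 ⟨i, rfl⟩ h.1

/-- **Odd moments vanish**: `∫_{[-π,π]³} (Σⱼ cos θⱼ)^{2n+1} = 0`. -/
theorem ccetGreen_moment_odd : ∀ n : ℕ, ∫ θ in brillouin 3, (∑ j, Real.cos (θ j)) ^ (2 * n + 1) = 0 := by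
  intro n
  rw [integral_sum_cos_pow]
  refine Finset.sum_eq_zero fun a ha => Finset.sum_eq_zero fun b hb => ?_
  have ha' : a ≤ 2 * n + 1 := by have := Finset.mem_range.1 ha; omega
  have hb' : b ≤ 2 * n + 1 - a := by have := Finset.mem_range.1 hb; omega
  rcases Nat.even_or_odd' a with ⟨i, rfl | rfl⟩
  · rcases Nat.even_or_odd' b with ⟨j, rfl | rfl⟩
    · rw [show 2 * n + 1 - 2 * i - 2 * j = 2 * (n - i - j) + 1 by omega,
        integral_Icc_cos_pow_two_mul_add_one]
      simp
    · rw [integral_Icc_cos_pow_two_mul_add_one]; simp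
  · rw [integral_Icc_cos_pow_two_mul_add_one]; simp

end Summit.CriticalPhenomena.Ising3DConformalLimit.Theorems.PerfectScreening.CcetGreen

end
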